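import Summits.QuantumFields.YangMills.Theorems.BalabanLadderIRColdPressurePincer
import Summits.QuantumFields.YangMills.Theorems.DoublingDefectRecursionToGapColdDefect
import HarnessLib

/-!
# Route `BalabanLadder`, crux `IR` (stmt-QuantumFields-19354): the COLD-PURITY BRIDGE — obligation Props and PROVED seams

Helper module (`--supports stmt-QuantumFields-19354`; no registered stub of 19354 is claimed, the slot of record stays
`Cruxes/IR/Lines/af_pincer_Uc_sharp.lean`).  Landed at the request of critic ym-ir-crit-2 (VERDICT `doubling-bridge`,
2026-08-27T23:51Z, price P4: «have the sorry-free seam landed as structural knowledge; seat no provers on E/R here»), by the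
ideator seat ym-ir-idea-6 g0 (lens: finite-size-scaling typed conjectures).  Sorry-free.  It records, kernel-checked, how the
two finite-size-scaling cruxes of the dormant route `DoublingDefect` (stmt-QuantumFields-17753 `OneTorusExit`,
stmt-QuantumFields-17754 `DoublingRecursion`) — re-typed on the simply-connected family in the COLD purity currency that the
route's own landed glue `DoublingDefect.recursionToGap_of_coldDefect` consumes — supply the LIVE leaf `BalabanLadder.IR`:

* `coldDefect ρ β L = 1 − Z_β(L³×2⌊L/4⌋)/Z_β(L³×⌊L/4⌋)²` — the cold period-doubling (purity) defect `= 1 − tr 𝒯^{2t}/(tr 𝒯^t)²`.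
* Obligation Props (OPEN, nothing claimed): **E** `ColdExitSC` (one pure cold torus per weak coupling), **R**
  `ColdDoublingRecursionSC` (quadratic contraction under dyadic doubling, one constant), **H** `FloorToPuritySC` (the
  `LowerBounds`-shaped two-point floor at resolution `1/s` forces an `ε₀`-pure cold torus of size `≤ k/s`, one window factor).
* PROVED: `coldPressureAt_of_exit_recursion` (exit ∧ recursion at one `β` ⇒ `ColdPressureAt`, group-blind: iterate R —
  `DoublingDefect.defect_decay_of_recursion` —, read the defect spectrally — `traceExcess_le_of_coldDefect_le`,
  `traceExcess_le_exp_of_le`); `coldPressureOnsetSC_of_bridge : R → E → ColdPressurePincer.ColdPressureOnsetSC`;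
  `IR_of_bridge : R → E → AFToColdPressure → IRnsc → BalabanLadder.IR` (line `doubling-bridge`);
  `irsc_of_handshake : H → R → ColdPressurePincer.IRsc` (NO asymptotic-freedom stub: the floor locates the pure scale; the
  same pure torus gives onset and the pin `a β · ξ⋆(β) ≤ k` via `cpLength_le`); `IR_of_handshake : H → R → IRnsc → IR`
  (line `floor-handshake`).

HONEST FRAMING.  The Yang–Mills mass gap (Clay) is NOT proved by anything here; R4 (`BalabanUVStability4`) closes only the
conditional finite-𝕋⁴ rung `BalabanLadder.UV`.  E, R, H are OPEN obligations carrying the infrared wall (E: vacuum dominance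
of one cold torus per `β`, false for `U(1)₄` and for `π₁(G) ≠ 1`; R: the Knabe-type bootstrap «asserted nowhere» for lattice
gauge theory, REDUCTION-CENSUS B15; H: confinement at the floor scale with asymptotic freedom in contrapositive).  This module
discharges no leg; it makes the wirings `E ∧ R ∧ AF-pin ∧ residual ⇒ IR` and `H ∧ R ∧ residual ⇒ IR` citable.
Cards: `Cruxes/IR/Lines/doubling-bridge.md`, `Cruxes/IR/Lines/floor-handshake.md`.

RUNGS (§5, strong-coupling window `0 ≤ β ≤ strongCouplingRadius ρ`, group-blind): PROVED `coldExitSC_strongCoupling` (E's body),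
PROVED `floorToPurity_conclusion_strongCoupling` (H's conclusion, floor-free), TYPED-OPEN `ColdDoublingRecursionStrongCoupling` (R).
SPECTRAL CURRENCY (rev 3, §6 here): `2x/(1+x)² ≤ δᶜ ≤ 2x` two-sided (`one_sub_ratio_ge_of_traceExcess`, PROVED) and the
PROVED EQUIVALENCE up to constants `coldDoublingRecursionSC_of_spectral : SpectralDiagonalContractionSC → ColdDoublingRecursionSC`,
`spectral_of_coldDoublingRecursionSC` (R in the transfer-matrix spectral currency: the excited thermal tower squares under
simultaneous space-and-time doubling past the exit).

LANDING NOTE (lead prover ym-ir-line-bsf-p1 g2, 2026-08-28): the ideator's 768-line module (rev 3b, evidence on 19354) is landed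
verbatim but SPLIT at the gate's 400-line limit into three files: this one (§§1–4: currency, obligation Props, seam,
compositions), `BalabanLadderIRColdPurityBridgeRungs.lean` (§5: strong-coupling rungs) and
`BalabanLadderIRColdPurityBridgeSpectral.lean` (§6: R in spectral currency).  Text and declarations unchanged.
-/

set_option autoImplicit false

noncomputable section

open Filter Topology MeasureTheory
open scoped SchwartzMap
open Literature.MathematicalPhysics.QuantumFieldTheory Literature.MathematicalPhysics.QuantumLattice
open Summit.QuantumFields.YangMills.Cruxes.OSLegsFromFemtoAndGap.DlrCollarTransfer (GapInUnits LowerBounds Q2)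
open Literature.MathematicalPhysics.QuantumFieldTheory.Balaban1983to89.Sufficient (ColdPressureBound)
open Summit.QuantumFields.YangMills.Theorems.DoublingDefect (coldDefect_nonneg traceExcess_le_of_coldDefect_le
  traceExcess_le_exp_of_le defect_decay_of_recursion)
open Summit.QuantumFields.YangMills.Cruxes.IR.ColdPressurePincer

namespace Summit.QuantumFields.YangMills.Cruxes.IR.ColdPurityBridge

/-! ## §1 The currency: the cold period-doubling (purity) defect -/

section Defs

variable {G : Type} [Group G] [TopologicalSpace G] [IsTopologicalGroup G] [CompactSpace G]
  [MeasurableSpace G] [BorelSpace G]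

/-- The **cold period-doubling defect** `δᶜ_β(L) = 1 − Z_β(L,L,L,2⌊L/4⌋) / Z_β(L,L,L,⌊L/4⌋)²` — VERBATIM the defect
of `DoublingDefect.recursionToGap_of_coldDefect` (there inlined; `wilsonFinTorusPartition` = the inline Haar integral
by `rfl`).  Observable-free; `∈ [0,1)` for `L ≥ 8`, `β ≥ 0` (`coldDefect_nonneg`). -/
def coldDefect {N : ℕ} (ρ : G →* Matrix (Fin N) (Fin N) ℂ) (β : ℝ) (L : ℕ) : ℝ :=
  1 - wilsonFinTorusPartition ρ β L L L (2 * (L / 4)) / wilsonFinTorusPartition ρ β L L L (L / 4) ^ 2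

end Defs

/-! ## §2 The obligation Props (OPEN; nothing claimed) -/

/-- **E — `ColdExitSC` (crux, rank 3): pure cold tori exist at every weak coupling (ONE scale per β).**
For compact simple SIMPLY-CONNECTED `G` and every lattice representation `r`: for every `ε > 0` there is `β₁` such
that for all `β ≥ β₁` and every `L₀` some `L ≥ L₀` has `δᶜ_β(L) ≤ ε`.  (Route `DoublingDefect`'s `OneTorusExit`,
stmt-QuantumFields-17753, in the cold currency = hypothesis `hE` of `recursionToGap_of_coldDefect`.)
Why it might fail: it is the weak-coupling confinement scale seen at ONE size: vacuum dominance of the cold torus needs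
`L ≳ ξ(β) log(L³/ε) ~ e^{cβ}`, beyond every expansion; `U(1)₄` fails it (photon gas), `SO(3)` fails it (light flux),
so any proof must use both non-abelianness and `π₁ = 1`.
Sources: Luscher1977; PrivmanFisher1983; Luscher1986; BorgsKotecky1990; route file `Theses/DoublingDefect.lean`;
`Literature.Barriers.QuantumFields.AbelianDeconfinementD4`. -/
def ColdExitSC : Prop :=
  ∀ (G : Type) [Group G] [TopologicalSpace G] [IsTopologicalGroup G] [CompactSpace G],
    IsCompactSimpleLieGroup G → SimplyConnectedSpace G →
    letI : MeasurableSpace G := borel G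
    haveI : BorelSpace G := ⟨rfl⟩
    ∀ r : LatticeRep G, ∀ ε : ℝ, 0 < ε → ∃ β₁ : ℝ, ∀ β : ℝ, β₁ ≤ β →
      ∀ L₀ : ℕ, ∃ L : ℕ, L₀ ≤ L ∧ coldDefect r.ρ β L ≤ ε

/-- **R — `ColdDoublingRecursionSC` (crux, rank 2 — the load-bearing scale transfer): the cold defect CONTRACTS
under dyadic doubling at fixed coupling.**  For compact simple simply-connected `G` and every `r` there are `C > 0`,
`β₀`, `L₀` with `δᶜ_β(L') ≤ C · δᶜ_β(L)²` for all `β ≥ β₀`, `L ≥ L₀`, `L' ∈ [2L, 4L]`.  (Route `DoublingDefect`'s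
`DoublingRecursion`, stmt-QuantumFields-17754, in the cold currency = hypothesis `hR` of `recursionToGap_of_coldDefect`.)
A Knabe-type finite-size bootstrap for Lüscher's transfer matrix with the MODEL-DEPENDENT threshold `1/(16C)`
(census B15: asserted nowhere for lattice gauge theory; C22: no universal threshold can exist — respected).
Why it might fail: light states fitting only the bigger box (a torus gap dropping under spatial doubling faster than
`O(log L / L)` while `δᶜ(L)` is already small) break the plain squaring; `C` uniform in `β ≥ β₀` may fail through the
`(m/2πt)^{3/2}`-type multiplicity prefactors if they are not scale-covariant along `β → ∞`.
Sources: Knabe1988; GossetMozgunov2016; Luscher1977; OsterwalderSeilerAnnPhys1978; Borgs1993; `pub/ym-ir/REDUCTION-CENSUS.md` B15. -/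
def ColdDoublingRecursionSC : Prop :=
  ∀ (G : Type) [Group G] [TopologicalSpace G] [IsTopologicalGroup G] [CompactSpace G],
    IsCompactSimpleLieGroup G → SimplyConnectedSpace G →
    letI : MeasurableSpace G := borel G
    haveI : BorelSpace G := ⟨rfl⟩
    ∀ r : LatticeRep G, ∃ C β₀ : ℝ, ∃ L₀ : ℕ, 0 < C ∧ ∀ β : ℝ, β₀ ≤ β → ∀ L : ℕ, L₀ ≤ L →
      ∀ L' : ℕ, 2 * L ≤ L' → L' ≤ 4 * L → coldDefect r.ρ β L' ≤ C * coldDefect r.ρ β L ^ 2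

/-- **H — `FloorToPuritySC` (crux, rank 2 — the handshake between the observable side and the partition-function side
at ONE scale).**  For compact simple SIMPLY-CONNECTED `G`, every lattice representation `r`, every real positive-time
test function `v`, every floor height `ε > 0`, torus threshold `Λ` and purity tolerance `ε₀ > 0` there are a coupling
threshold `β₀`, a resolution threshold `s₀ > 0` and a window factor `k` such that for all `β ≥ β₀` and all spacings
`0 < s ≤ s₀`: IF the smeared truncated two-point function of the action density at spacing `s` is floored,
`ε ≤ Q2 G r β L s (Θv) v` on every torus with `s · L ≥ Λ` (exactly the shape `LowerBounds`(i) provides at `s = a β`),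
THEN some torus of linear size `L' ∈ [1/s, k/s]`, `L' ≥ 8`, is `ε₀`-pure: `δᶜ_β(L') ≤ ε₀`.
Content: the floor scale (where the observable coupling `Q2 ≍ ḡ⁴(1/s)` has reached `ε`) and the purity scale (where one
state dominates the cold spatial torus) differ by a factor bounded UNIFORMLY in `β` — no strongly-coupled mixed window —
and (in contrapositive) no floor occurs at resolutions finer than `1/k` of a pure size (the asymptotic-freedom half,
fused; NOT eliminated).  Conditional in the way `IR` is: purity is asserted only where a floor is observed.
Why it might fail: a window of scales between «`ḡ(ℓ) ≥ ε^{1/4}`» and «vacuum dominance at `4ℓ … kℓ`» whose width grows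
with `β` (confinement setting in parametrically later than strong observable coupling) falsifies the uniform `k`; nothing
rigorous excludes it, and at `U(1)₄` (Coulomb phase: floor at all scales, `δᶜ ≡ 1 − e^{−26.3}`) and at `π₁(G) ≠ 1`
(light 't Hooft flux vacua, `δᶜ → 1 − |π₁|⁻³`) the implication is FALSE — a proof must use non-abelianness and `π₁ = 1`.
Sources: Luscher1983 (femto-universe, NPB 219), vanBaalKoller1987, Luscher1977, PrivmanFisher1983, Guth1980 /
FrohlichSpencer1982 (the `U(1)₄` Coulomb phase), `Literature.Barriers.QuantumFields.AbelianDeconfinementD4`,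
`pub/ym-ir/REDUCTION-CENSUS.md` B7 (the femto→IR hand-over IS the crux). -/
def FloorToPuritySC : Prop :=
  ∀ (G : Type) [Group G] [TopologicalSpace G] [IsTopologicalGroup G] [CompactSpace G],
    IsCompactSimpleLieGroup G → SimplyConnectedSpace G →
    letI : MeasurableSpace G := borel G
    haveI : BorelSpace G := ⟨rfl⟩
    ∀ (r : LatticeRep G) (v : 𝓢(EuclideanSpace ℝ (Fin 4), ℝ)),
      tsupport v ⊆ {y : EuclideanSpace ℝ (Fin 4) | 0 < y 0} →
      ∀ (ε Λ ε₀ : ℝ), 0 < ε → 0 < ε₀ →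
        ∃ (β₀ s₀ k : ℝ), 0 < s₀ ∧ ∀ β : ℝ, β₀ ≤ β → ∀ s : ℝ, 0 < s → s ≤ s₀ →
          (∀ L : ℕ, Λ ≤ s * L → ε ≤ Q2 G r β L s (thetaTest 4 v) v) →
            ∃ L' : ℕ, 8 ≤ L' ∧ 1 / s ≤ (L' : ℝ) ∧ (L' : ℝ) ≤ k / s ∧ coldDefect r.ρ β L' ≤ ε₀

/-! ## §3 The seam, PROVED: exit ∧ recursion at one β ⇒ cold pressure at that β -/

section Seam

variable {G : Type} [Group G] [TopologicalSpace G] [IsTopologicalGroup G] [CompactSpace G]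
  [MeasurableSpace G] [BorelSpace G]

/-- **Seam (PROVED; the first two thirds of `DoublingDefect.recursionToGap_of_coldDefect`, group-blind, one β).**
If at coupling `β ≥ 0` the cold defect obeys the doubling recursion with constant `C` beyond `L₀` and exits below
`1/(16·max C 2)` at some scale `L⋆ ≥ max L₀ 8`, then cold pressure holds at `β` with length `L⋆`:
iterate (`defect_decay_of_recursion`: `δᶜ_β(L) ≤ C'^{-1} e^{−(L+1)/L⋆}` for `L ≥ 2L⋆`), read spectrally at
`P = 2S+1 ≥ 2L⋆` (`traceExcess_le_of_coldDefect_le`: `x_{⌊P/4⌋} ≤ 2δᶜ ≤ e^{−(4/L⋆)⌊P/4⌋}`), propagate to every cold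
extent (`traceExcess_le_exp_of_le`), and weaken the rate `4/L⋆` to `1/L⋆`. -/
theorem coldPressureAt_of_exit_recursion (r : LatticeRep G) {β : ℝ} (hβ0 : 0 ≤ β) {C : ℝ} (hC : 0 < C)
    {L₀ : ℕ}
    (hrec : ∀ L : ℕ, L₀ ≤ L → ∀ L' : ℕ, 2 * L ≤ L' → L' ≤ 4 * L →
      coldDefect r.ρ β L' ≤ C * coldDefect r.ρ β L ^ 2)
    {Ls : ℕ} (hLs : max L₀ 8 ≤ Ls) (hex : coldDefect r.ρ β Ls ≤ 1 / (16 * max C 2)) :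
    ColdPressureAt r.ρ β Ls := by
  haveI : SecondCountableTopology G :=
    (r.continuous.isClosedEmbedding r.injective).isEmbedding.secondCountableTopology
  -- WLOG `C ≥ 2`
  set C' : ℝ := max C 2 with hC'def
  have hC' : 0 < C' := lt_of_lt_of_le hC (le_max_left _ _)
  have hC'2 : 2 ≤ C' := le_max_right _ _
  have hrec' : ∀ L : ℕ, L₀ ≤ L → ∀ L' : ℕ, 2 * L ≤ L' → L' ≤ 4 * L →
      coldDefect r.ρ β L' ≤ C' * coldDefect r.ρ β L ^ 2 := fun L hL L' h2 h4 =>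
    (hrec L hL L' h2 h4).trans (mul_le_mul_of_nonneg_right (le_max_left _ _) (sq_nonneg _))
  -- the cold defect is non-negative at every scale `L ≥ 8`
  have hnn : ∀ L : ℕ, 8 ≤ L → 0 ≤ coldDefect r.ρ β L := fun L hL => by
    haveI : NeZero L := ⟨by omega⟩
    exact coldDefect_nonneg r.continuous r.mem_unitary hβ0 L (L / 4) (by omega)
  have hLs8 : 8 ≤ Ls := le_trans (le_max_right _ _) hLs
  have hdec := defect_decay_of_recursion (δ := coldDefect r.ρ β) (L₀ := max L₀ 8) (Ls := Ls) hC'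
    (fun L hL L' h2 h4 => hrec' L (le_trans (le_max_left _ _) hL) L' h2 h4)
    (fun L hL => hnn L (le_trans (le_max_right _ _) hL)) hLs (by omega) hex
  have hLsR : (0 : ℝ) < Ls := by exact_mod_cast (by omega : 0 < Ls)
  -- cold pressure with `C₀ = 1`, `S₁ = L⋆`, rate `1 / L⋆`
  refine ⟨1, Ls, zero_le_one, fun S hS m hm => ?_⟩
  -- `P = 2S+1 ≥ 2 L⋆`, `t₀ = ⌊P/4⌋ = m₀ + 2 ≥ 4`
  obtain ⟨m₀, hm₀⟩ : ∃ m₀ : ℕ, (2 * S + 1) / 4 = m₀ + 2 := ⟨(2 * S + 1) / 4 - 2, by omega⟩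
  have hm₀m : m₀ ≤ m := by omega
  have hP : 2 * Ls ≤ 2 * S + 1 := by omega
  -- `δᶜ_β(P) ≤ C'⁻¹ e^{−(P+1)/L⋆} ≤ 1/2`
  have hδP := hdec (2 * S + 1) hP
  have hexp1 : Real.exp (-((((2 * S + 1 : ℕ) : ℝ) + 1) / Ls)) ≤ 1 :=
    Real.exp_le_one_iff.2 (by
      have : (0 : ℝ) ≤ (((2 * S + 1 : ℕ) : ℝ) + 1) / Ls := by positivity
      linarith)
  have hCinv : C'⁻¹ ≤ 1 / 2 := by rw [inv_eq_one_div]; exact one_div_le_one_div_of_le two_pos hC'2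
  have hCinv0 : 0 ≤ C'⁻¹ := inv_nonneg.2 hC'.le
  have hδhalf : coldDefect r.ρ β (2 * S + 1) ≤ 1 / 2 :=
    hδP.trans ((mul_le_mul hCinv hexp1 (Real.exp_pos _).le (by norm_num)).trans (by norm_num))
  -- `x_{t₀} ≤ 2 δᶜ_β(P)`
  have hδP' : 1 - wilsonFinTorusPartition r.ρ β (2 * S + 1) (2 * S + 1) (2 * S + 1) (2 * (m₀ + 2)) /
      wilsonFinTorusPartition r.ρ β (2 * S + 1) (2 * S + 1) (2 * S + 1) (m₀ + 2) ^ 2 ≤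
        coldDefect r.ρ β (2 * S + 1) := by
    unfold coldDefect
    rw [hm₀]
  have hx₀ := traceExcess_le_of_coldDefect_le r.continuous r.mem_unitary hβ0 (2 * S + 1) m₀ hδhalf hδP'
  -- `2 δᶜ_β(P) ≤ e^{−(P+1)/L⋆} ≤ e^{−(4/L⋆) t₀}`
  have h2δ : 2 * coldDefect r.ρ β (2 * S + 1) ≤ Real.exp (-(4 / Ls * ((m₀ + 2 : ℕ) : ℝ))) := by
    have h1 : 2 * coldDefect r.ρ β (2 * S + 1) ≤ Real.exp (-((((2 * S + 1 : ℕ) : ℝ) + 1) / Ls)) := by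
      have h := mul_le_mul_of_nonneg_left hδP zero_le_two
      refine h.trans ?_
      rw [← mul_assoc]
      have h2C : 2 * C'⁻¹ ≤ 1 := by linarith
      exact (mul_le_of_le_one_left (Real.exp_pos _).le h2C)
    refine h1.trans (Real.exp_le_exp.2 ?_)
    have ht₀ : 4 * ((m₀ + 2 : ℕ) : ℝ) ≤ ((2 * S + 1 : ℕ) : ℝ) + 1 := by
      have h : 4 * (m₀ + 2) ≤ 2 * S + 1 + 1 := by omega
      exact_mod_cast h
    rw [neg_le_neg_iff, div_mul_eq_mul_div, div_le_div_iff_of_pos_right hLsR]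
    exact ht₀
  have hx₀' : traceExcess r.ρ β (2 * S + 1) (m₀ + 2) ≤ Real.exp (-(4 / Ls * ((m₀ + 2 : ℕ) : ℝ))) :=
    hx₀.trans h2δ
  -- propagate to the extent `m + 2 ≥ t₀`
  have hxm := traceExcess_le_exp_of_le r.continuous r.mem_unitary hβ0 (2 * S + 1) hm₀m hx₀'
  refine hxm.trans ?_
  -- weaken the rate `4/L⋆ ↦ 1/L⋆` and the constant `1 ↦ 1 · (2S+1)³`
  have hrate : Real.exp (-(4 / Ls * ((m + 2 : ℕ) : ℝ))) ≤
      Real.exp (-(1 / (Ls : ℝ) * ((m + 2 : ℕ) : ℝ))) := by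
    refine Real.exp_le_exp.2 ?_
    rw [neg_le_neg_iff]
    have hm2 : (0 : ℝ) ≤ ((m + 2 : ℕ) : ℝ) := by positivity
    have h14 : 1 / (Ls : ℝ) ≤ 4 / Ls := by
      rw [div_le_div_iff_of_pos_right hLsR]; norm_num
    exact mul_le_mul_of_nonneg_right h14 hm2
  refine hrate.trans ?_
  have hV : (1 : ℝ) ≤ 1 * ((2 * S + 1 : ℕ) : ℝ) ^ 3 := by
    rw [one_mul]
    exact one_le_pow₀ (by exact_mod_cast (by omega : 1 ≤ 2 * S + 1))
  exact le_mul_of_one_le_left (Real.exp_pos _).le hV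

end Seam

/-! ## §4 Compositions, PROVED -/

/-- **E ∧ R ⇒ the pincer's stub `ColdPressureOnsetSC`** (REAL proof): per `(G, r)`, `R` gives `(C, β₀, L₀)`; `E` at the
tolerance `1/(16·max C 2)` gives `β₁`; for `β ≥ max(β₀, β₁, 0)` an exit scale `L⋆ ≥ max(L₀, 8)` exists and the seam
yields `ColdPressureAt r.ρ β L⋆` with `L⋆ ≥ 8 ≥ 1`. -/
theorem coldPressureOnsetSC_of_bridge (hR : ColdDoublingRecursionSC) (hE : ColdExitSC) : ColdPressureOnsetSC := by
  intro G _ _ _ _ hG hsc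
  letI : MeasurableSpace G := borel G
  haveI : BorelSpace G := ⟨rfl⟩
  intro r
  obtain ⟨C, β₀, L₀, hC, hrec⟩ := hR G hG hsc r
  have hC' : 0 < max C 2 := lt_of_lt_of_le hC (le_max_left _ _)
  obtain ⟨β₁, hβ₁⟩ := hE G hG hsc r (1 / (16 * max C 2)) (by positivity)
  refine ⟨max β₀ (max β₁ 0), fun β hβ => ?_⟩
  have hββ₀ : β₀ ≤ β := le_trans (le_max_left _ _) hβ
  have hββ₁ : β₁ ≤ β := le_trans ((le_max_left _ _).trans (le_max_right _ _)) hβ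
  have hβ0 : 0 ≤ β := le_trans ((le_max_right _ _).trans (le_max_right _ _)) hβ
  obtain ⟨Ls, hLs, hex⟩ := hβ₁ β hββ₁ (max L₀ 8)
  exact ⟨Ls, by omega, coldPressureAt_of_exit_recursion r hβ0 hC (hrec β hββ₀) hLs hex⟩

/-- **The line concludes the crux `IR` BY NAME** from E, R (this line's IR side), X (the pincer's AF pin, by name) and the
residual N (by name): `ColdPressurePincer.IR_of_cp_repaired` over `coldPressureOnsetSC_of_bridge`. Kernel-checked, no sorry. -/
theorem IR_of_bridge (hR : ColdDoublingRecursionSC) (hE : ColdExitSC) (hX : AFToColdPressure) (hN : IRnsc) :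
    Summit.QuantumFields.YangMills.Theses.BalabanLadder.IR :=
  IR_of_cp_repaired (coldPressureOnsetSC_of_bridge hR hE) hX hN

/-- **H ∧ R ⇒ `IRsc` (REAL proof, no AF stub).**  Per `(G, r, a)` under `LowerBounds G r a`: R gives `(C, β₀, L₀)`; H at
`(v, ε₅, Λ₅, ε₀ := 1/(16·max C 2))` gives `(β_H, s₀, k)`; `a → 0` gives `β_a` with `a β ≤ min s₀ (1/max L₀ 8)` beyond it.
For `β ≥ β⋆ := max (max β₅ β₀) (max β_H (max β_a 0))` the floor `LowerBounds`(i) at `s = a β` triggers H: an `ε₀`-pure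
torus `L' ∈ [1/aβ, k/aβ]`, `L' ≥ max L₀ 8`; the seam gives `ColdPressureAt r.ρ β L'`, hence the onset witness `L' ≥ 1`
and the pin `a β · ξ⋆(β) ≤ a β · L' ≤ k < k + 1` (`cpLength_le`); `gapInUnits_of_coldPressure_pinned` concludes. -/
theorem irsc_of_handshake (hH : FloorToPuritySC) (hR : ColdDoublingRecursionSC) : IRsc := by
  intro G _ _ _ _ hG hsc
  letI : MeasurableSpace G := borel G
  haveI : BorelSpace G := ⟨rfl⟩
  intro r a ha ha0 hlb
  obtain ⟨⟨v, ε, β₅, Λ₅, hv, hε, hfloor⟩, -⟩ := hlb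
  obtain ⟨C, β₀, L₀, hC, hrec⟩ := hR G hG hsc r
  have hC' : 0 < max C 2 := lt_of_lt_of_le hC (le_max_left _ _)
  obtain ⟨βH, s₀, k, hs₀, hHβ⟩ := hH G hG hsc r v hv ε Λ₅ (1 / (16 * max C 2)) hε (by positivity)
  -- `a β` is eventually below `s₀` and below `1 / max L₀ 8`
  set M : ℕ := max L₀ 8 with hMdef
  have hM8 : 8 ≤ M := le_max_right _ _
  have hMpos : (0 : ℝ) < (M : ℝ) := by exact_mod_cast (lt_of_lt_of_le (by norm_num : 0 < 8) hM8)
  have hmin : 0 < min s₀ (1 / (M : ℝ)) := lt_min hs₀ (by positivity)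
  obtain ⟨βa, hβa⟩ : ∃ βa : ℝ, ∀ β : ℝ, βa ≤ β → a β ≤ min s₀ (1 / (M : ℝ)) := by
    have hev : ∀ᶠ β in atTop, a β < min s₀ (1 / (M : ℝ)) := ha0.eventually (gt_mem_nhds hmin)
    obtain ⟨βa, h⟩ := Filter.eventually_atTop.1 hev
    exact ⟨βa, fun β hβ => (h β hβ).le⟩
  set βs : ℝ := max (max β₅ β₀) (max βH (max βa 0)) with hβsdef
  -- the key step: for `β ≥ β⋆`, a pure torus `L'` with `a β · L' ≤ k` carrying cold pressure
  have key : ∀ β : ℝ, βs ≤ β → ∃ L' : ℕ, 1 ≤ L' ∧ a β * (L' : ℝ) ≤ k ∧ ColdPressureAt r.ρ β L' := by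
    intro β hβ
    have hβ5 : β₅ ≤ β := le_trans ((le_max_left _ _).trans (le_max_left _ _)) hβ
    have hβ0 : β₀ ≤ β := le_trans ((le_max_right _ _).trans (le_max_left _ _)) hβ
    have hβH : βH ≤ β := le_trans ((le_max_left _ _).trans (le_max_right _ _)) hβ
    have hβa' : βa ≤ β :=
      le_trans (((le_max_left _ _).trans (le_max_right _ _)).trans (le_max_right _ _)) hβ
    have hβ00 : (0 : ℝ) ≤ β :=
      le_trans (((le_max_right _ _).trans (le_max_right _ _)).trans (le_max_right _ _)) hβ
    have has₀ : a β ≤ s₀ := (hβa β hβa').trans (min_le_left _ _)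
    have haM : a β ≤ 1 / (M : ℝ) := (hβa β hβa').trans (min_le_right _ _)
    obtain ⟨L', h8, h1, h2, h3⟩ := hHβ β hβH (a β) (ha β) has₀ (fun L hL => hfloor β hβ5 L hL)
    -- `L' ≥ M`: from `1 / a β ≤ L'` and `a β ≤ 1 / M`
    have hML'R : (M : ℝ) ≤ (L' : ℝ) := ((le_one_div hMpos (ha β)).2 haM).trans h1
    have hML' : M ≤ L' := by exact_mod_cast hML'R
    have hcp : ColdPressureAt r.ρ β L' :=
      coldPressureAt_of_exit_recursion r hβ00 hC (hrec β hβ0) (Ls := L') hML' h3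
    have hk : a β * (L' : ℝ) ≤ k := by
      have h := (le_div_iff₀ (ha β)).1 h2
      simpa [mul_comm] using h
    exact ⟨L', by omega, hk, hcp⟩
  refine gapInUnits_of_coldPressure_pinned r a ha ha0 (β₂ := βs) (fun β hβ => ?_) (T := k + 1) (β₆ := βs)
    (fun β hβ => ?_)
  · obtain ⟨L', h1, -, h3⟩ := key β hβ
    exact ⟨L', h1, h3⟩
  · obtain ⟨L', h1, h2, h3⟩ := key β hβ
    have hle : (cpLength r.ρ β : ℝ) ≤ (L' : ℝ) := by exact_mod_cast cpLength_le r.ρ β h1 h3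
    have hmul := mul_le_mul_of_nonneg_left hle (ha β).le
    linarith

/-- **The line concludes `IRsc` and then the crux `IR` BY NAME** from H, R and the residual N (`IR_of_cases`, tree). -/
theorem IR_of_handshake (hH : FloorToPuritySC) (hR : ColdDoublingRecursionSC) (hN : IRnsc) :
    Summit.QuantumFields.YangMills.Theses.BalabanLadder.IR :=
  IR_of_cases (irsc_of_handshake hH hR) hN

end Summit.QuantumFields.YangMills.Cruxes.IR.ColdPurityBridge

end
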